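import Literature.MathematicalPhysics.QuantumLattice.HubbardTruncatedCoeffLimit
import Literature.MathematicalPhysics.QuantumLattice.FermionicTreeExpansionPointwise
import Literature.MathematicalPhysics.QuantumLattice.OrderedIntegralLimit
import HarnessLib

/-!
# The thermodynamic limit of the truncated coefficients `t_j(L)`: domination and assembly

Topic `MathematicalPhysics/QuantumLattice`; programme under the tree's fact `bgm_two_point_limit`
(`HubbardFermiLiquid.lean`; Benfatto–Giuliani–Mastropietro, Ann. Henri Poincaré 7 (2006) 809).
Continuation of `HubbardTruncatedCoeffLimit.lean` (bridge and entrywise limits).  PROVED here: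
hypothesis (B) of `HubbardTwoPointLimitReduction.bgm_two_point_limit_of_truncated_bounds` — the
**termwise (order-by-order) thermodynamic limit of the linked-cluster coefficients**,

`t_j(L) = hubbardTorusTruncatedCoeff β μ L x y σ σ' j ⟶ τ_j = hubbardInfTruncatedCoeff β μ x y σ σ' j`
(`tendsto_hubbardTorusTruncatedCoeff`, every `β ≥ 0`, `μ`, sites, spins and order `j`), with
`τ_j = (-β)^j ∫_{Δ_j} Σ_{Z ∈ (ℤ²)^j} 𝓔ᵀ_{∞}(x, y; Z, -βv) dv` the same coefficient built on the
infinite-volume propagator `g = freePropagatorInfiniteTime β μ`.  The mechanism (BGM §2.3,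
footnote 1: bounds uniform in `L`, then the limit):

* **domination** (`exists_norm_twoPointUrsellZ_le`): for `L ≥ 3`, vertex times in `[-β, 0]` and
  CENTRED vertex positions `Z`, `|𝓔ᵀ_L(x, y; Z)| ≤ D (1 + ‖Z‖_∞)^{-K}` with `D, K` independent of
  `L` (`K = 4j + 4`): the fixed-order tree bound for a bounded propagator
  (`FermionicTree.norm_ursellOf_moment_le_lineBound`) with the uniform-in-`L` torus-distance decay
  of the free propagator (`exists_norm_hubbardThermalTwoPointEvolved_zero_interaction_le_of_Icc'`)
  along the lines of the anchored cluster trees, and the LONG-LINE lemma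
  (`Script.exists_line_lt_of_lt_apply_y`): a vertex at torus distance `R` from `x` forces a tree line
  of torus length `≳ R/j`, whence the decay in `‖Z‖_∞`; `(1 + ‖Z‖)^{-K}` is summable over `(ℤ²)^j`;
* **Tannery** over the centred configurations (`sum_twoPointUrsell_torus_eq_tsum`,
  `tendsto_twoPointUrsellZ`, `eventually_isCentred`) gives the limit of the position sums at fixed
  times, and **dominated convergence for the ordered time integrals**
  (`tendsto_orderedIntegral_of_dominated'`) the limit of `t_j(L)`.

Consequently hypothesis (B) of the reduction holds unconditionally
(`termwise_limit_hubbardTorusTruncatedCoeff`); what remains of `bgm_two_point_limit` after this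
file is hypothesis (A) alone: the geometric bound `‖t_j(L)‖ ≤ C/rʲ` with `r > |U|` UNIFORM in `L` in
BGM's regime `β ≤ e^{c/|U|}` — the content of their renormalization-group analysis (Thm. 2.1, §3).
Everything is PROVED; the definitions are the limit coefficient and bookkeeping (torus norm of an
integer vector, cluster distances).

## References

* G. Benfatto, A. Giuliani, V. Mastropietro, Ann. Henri Poincaré 7 (2006) 809–898, §2.2–2.3,
  (2.14)–(2.16), footnote 1 of §2.3, (2.66)–(2.77) (arXiv:cond-mat/0507686 pp. 6–8, 14–15).
  [BenfattoGiulianiMastropietro2006]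
* G. Benfatto, V. Mastropietro, Rev. Math. Phys. 13 (2001) 1323–1435, §2 (finite-volume bounds
  uniform in `L`). [BenfattoMastropietro2001]
-/

noncomputable section

open scoped Matrix.Norms.L2Operator ComplexOrder
open Finset MeasureTheory Filter Topology NormedSpace Set
open Literature.Probability.LatticeModels Literature.Probability.LatticeModels.BattleFederbush

namespace Literature.MathematicalPhysics.QuantumLattice

/-! ### The torus norm of an integer vector -/

section TorusNorm

variable {d : ℕ}

/-- The torus sup-norm of the class of `w ∈ ℤ^d` mod `L`: `‖cRep (proj w)‖_∞`. [folklore] -/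
def tnZ (L : ℕ) (w : Site d) : ℕ := Torus.tnorm (Torus.proj L w)

-- `Torus.proj` is additive: this is `torusProj_add` of `LroInfraredBound.lean` / `Torus.proj_add` of
-- `TwoPointLogConvex.lean`, re-proved privately here to keep the Ising machinery out of the import
-- closure of the Hubbard cluster expansion (as in `TorusCentredLift.lean`).
/-- `proj` is additive. [folklore] -/
private theorem Torus.proj_add_site (L : ℕ) (a b : Site d) :
    Torus.proj L (a + b) = Torus.proj L a + Torus.proj L b := by
  funext i; simp [Torus.proj_apply]

/-- `proj` commutes with negation. [folklore] -/
private theorem Torus.proj_neg_site (L : ℕ) (a : Site d) : Torus.proj L (-a) = -Torus.proj L a := by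
  funext i; simp [Torus.proj_apply]

/-- `tnZ` is even. [folklore] -/
theorem tnZ_neg {L : ℕ} [NeZero L] (w : Site d) : tnZ L (-w) = tnZ L w := by
  unfold tnZ
  rw [Torus.proj_neg_site]
  refine le_antisymm (Torus.tnorm_neg_le _) ?_
  simpa using Torus.tnorm_neg_le (-Torus.proj L w)

/-- `tnZ (a - b) = tnZ (b - a)`. [folklore] -/
theorem tnZ_sub_comm {L : ℕ} [NeZero L] (a b : Site d) : tnZ L (a - b) = tnZ L (b - a) := by
  rw [← tnZ_neg, neg_sub]

/-- Triangle inequality. [folklore] -/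
theorem tnZ_add_le {L : ℕ} [NeZero L] (a b : Site d) : tnZ L (a + b) ≤ tnZ L a + tnZ L b := by
  unfold tnZ
  rw [Torus.proj_add_site]
  exact Torus.tnorm_add_le _ _

/-- `tnZ w ≤ ‖w‖_∞`. [folklore] -/
theorem tnZ_le_supNorm {L : ℕ} [NeZero L] (w : Site d) : tnZ L w ≤ Site.supNorm w := Torus.tnorm_proj_le w

/-- For a centred vector the torus norm is the sup-norm. [folklore] -/
theorem tnZ_eq_supNorm_of_centred (L : ℕ) {w : Site d} (h : Torus.cRep (Torus.proj L w) = w) :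
    tnZ L w = Site.supNorm w := by
  unfold tnZ Torus.tnorm
  rw [h]

/-- `tnZ` depends only on the class: `tnZ (w + Lm) = tnZ w`. [folklore] -/
theorem tnZ_add_zsmul (L : ℕ) (w m : Site d) : tnZ L (w + (L : ℤ) • m) = tnZ L w := by
  unfold tnZ
  rw [Torus.proj_add_zsmul]

/-- `2 tnZ w ≤ L`. [folklore] -/
theorem two_mul_tnZ_le {L : ℕ} [NeZero L] (w : Site d) : 2 * tnZ L w ≤ L := by
  unfold tnZ Torus.tnorm Site.supNorm
  rcases Nat.eq_zero_or_pos d with hd | hd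
  · subst hd; simp
  · haveI : Nonempty (Fin d) := ⟨⟨0, hd⟩⟩
    obtain ⟨i, -, hi⟩ := Finset.exists_mem_eq_sup' Finset.univ_nonempty
      (fun i : Fin d => (Torus.cRep (Torus.proj L w) i).natAbs)
    rw [← Finset.sup'_eq_sup Finset.univ_nonempty, hi]
    exact Torus.two_mul_natAbs_cRepZ_le _

/-- Reverse triangle inequality: `tnZ a - tnZ b ≤ tnZ (a - b)` (in `ℝ`). [folklore] -/
theorem tnZ_sub_le_real {L : ℕ} [NeZero L] (a b : Site d) : (tnZ L a : ℝ) - tnZ L b ≤ tnZ L (a - b) := by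
  have h := tnZ_add_le (L := L) (a - b) b
  rw [sub_add_cancel] at h
  have h' : (tnZ L a : ℝ) ≤ tnZ L (a - b) + tnZ L b := by exact_mod_cast h
  linarith

end TorusNorm

/-! ### The uniform entry bound in the torus norm -/

section EntryBound

variable (β μ : ℝ)

/-- **Uniform-in-`L` decay of the free torus propagator in the torus norm of the separation**:
for time separations in `[a, b]` and `K ≥ 4` there is `C > 0` with
`|⟨a⁺_{x₁σ₁}(t) a⁻_{y₁σ₂}(s)⟩_{β,L,0}| ≤ C (1 + tnZ_L(y₁ - x₁))^{-K}` for all `L ≥ 3`.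
[cite: BenfattoGiulianiMastropietro2006, §2.2] -/
theorem exists_norm_hubbardThermalTwoPointEvolved_le_tnZ (a b : ℝ) {K : ℕ} (hK : 4 ≤ K) :
    ∃ C : ℝ, 0 < C ∧ ∀ (L : ℕ), 3 ≤ L → ∀ (t s : ℝ), s - t ∈ Icc a b →
      ∀ (x₁ y₁ : Site 2) (σ₁ σ₂ : Fin 2),
        ‖hubbardThermalTwoPointEvolved β 0 μ L x₁ σ₁ (t : ℂ) y₁ σ₂ (s : ℂ)‖ ≤
          C * ((1 + (tnZ L (y₁ - x₁) : ℝ)) ^ K)⁻¹ := by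
  obtain ⟨C, hC0, hC⟩ :=
    exists_norm_hubbardThermalTwoPointEvolved_zero_interaction_le_of_Icc' β μ a b hK
  refine ⟨C + 1, by linarith, fun L hL t s hts x₁ y₁ σ₁ σ₂ => ?_⟩
  haveI : NeZero L := ⟨by omega⟩
  obtain ⟨z, m, hz, -, hb⟩ := hC L hL t s hts x₁ y₁ σ₁ σ₂
  have htn : (tnZ L (y₁ - x₁) : ℝ) ≤ ‖z‖ := by
    rw [Site.norm_eq_supNorm, ← tnZ_add_zsmul L (y₁ - x₁) m, ← hz]
    exact_mod_cast tnZ_le_supNorm z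
  have h0 : (0 : ℝ) ≤ tnZ L (y₁ - x₁) := Nat.cast_nonneg _
  calc ‖hubbardThermalTwoPointEvolved β 0 μ L x₁ σ₁ (t : ℂ) y₁ σ₂ (s : ℂ)‖ ≤ C * ((1 + ‖z‖) ^ K)⁻¹ := hb
    _ ≤ C * ((1 + (tnZ L (y₁ - x₁) : ℝ)) ^ K)⁻¹ := by
        refine mul_le_mul_of_nonneg_left ?_ hC0
        exact inv_anti₀ (by positivity) (pow_le_pow_left₀ (by positivity) (by linarith) K)
    _ ≤ (C + 1) * ((1 + (tnZ L (y₁ - x₁) : ℝ)) ^ K)⁻¹ :=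
        mul_le_mul_of_nonneg_right (by linarith) (by positivity)

variable {β}

/-- The real word times of vertex times in `[-β, 0]` lie in `[-β, 0]` (`β ≥ 0`). [folklore] -/
theorem hubbardWordTimeR_mem {j : ℕ} (hβ : 0 ≤ β) {w : Fin j → ℝ} (hw : ∀ i, w i ∈ Icc (-β) 0)
    (a : Fin (j * 2 + 1)) : hubbardWordTimeR w a ∈ Icc (-β) 0 := by
  induction a using Fin.cases with
  | zero => rw [hubbardWordTimeR_zero]; exact ⟨by linarith, le_rfl⟩
  | succ m => rw [hubbardWordTimeR_succ]; exact hw _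

variable (β)

/-- **The entries of the word matrix are uniformly small in the torus distance of the pair**: with
`C, K` as in `exists_norm_hubbardThermalTwoPointEvolved_le_tnZ` for the separations `[-2β, β]`,
vertex times `w ∈ [-β, 0]^j` and `L ≥ 3`,
`|M_L(a, b)| ≤ C (1 + tnZ_L(pos_b - pos_a))^{-K}`. [cite: BenfattoGiulianiMastropietro2006, §2.2] -/
theorem norm_torusWordMatrix_apply_le (hβ : 0 ≤ β) {K : ℕ} {C : ℝ}
    (hC : ∀ (L : ℕ), 3 ≤ L → ∀ (t s : ℝ), s - t ∈ Icc (-(2 * β)) β →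
      ∀ (x₁ y₁ : Site 2) (σ₁ σ₂ : Fin 2),
        ‖hubbardThermalTwoPointEvolved β 0 μ L x₁ σ₁ (t : ℂ) y₁ σ₂ (s : ℂ)‖ ≤
          C * ((1 + (tnZ L (y₁ - x₁) : ℝ)) ^ K)⁻¹)
    {L : ℕ} (hL : 3 ≤ L) (x y : Site 2) (σ σ' : Fin 2) {j : ℕ} (Z : Fin j → Site 2)
    {w : Fin j → ℝ} (hw : ∀ i, w i ∈ Icc (-β) 0) (a b : Fin (j * 2 + 1)) :
    ‖torusWordMatrix β μ L x y σ σ' Z (fun i => ((w i : ℝ) : ℂ)) a b‖ ≤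
      C * ((1 + (tnZ L (hubbardWordPos y Z b - hubbardWordPos x Z a) : ℝ)) ^ K)⁻¹ := by
  have ha := hubbardWordTimeR_mem hβ hw a
  have hb := hubbardWordTimeR_mem hβ hw b
  simp only [torusWordMatrix, Matrix.of_apply, hubbardWordTime_ofReal]
  split_ifs with hab
  · exact hC L hL _ _ ⟨by linarith [ha.1, ha.2, hb.1, hb.2], by linarith [ha.1, ha.2, hb.1, hb.2]⟩ _ _ _ _
  · rw [norm_neg, show ((hubbardWordTimeR w b : ℝ) : ℂ) - (β : ℂ) = ((hubbardWordTimeR w b - β : ℝ) : ℂ) by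
      push_cast; ring]
    exact hC L hL _ _ ⟨by linarith [ha.1, ha.2, hb.1, hb.2], by linarith [ha.1, ha.2, hb.1, hb.2]⟩ _ _ _ _

end EntryBound

/-! ### Cluster distances, the line bound and the potential -/

section Clusters

variable {j : ℕ} (L : ℕ) (x y : Site 2) (Z : Fin j → Site 2)

/-- The (symmetrised) torus distance between two clusters of the two-point word: between two
vertices the torus distance of their positions, between the external pair and a vertex the
smaller of the distances to `x` and to `y`, zero on the diagonal of the external pair. [folklore] -/
def clusterDist : Option (Fin j) → Option (Fin j) → ℕ
  | none, none => 0
  | none, some i => min (tnZ L (Z i - x)) (tnZ L (Z i - y))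
  | some i, none => min (tnZ L (Z i - x)) (tnZ L (Z i - y))
  | some i, some i' => min (tnZ L (Z i - Z i')) (tnZ L (Z i' - Z i))

/-- `clusterDist` is symmetric. [folklore] -/
theorem clusterDist_comm (u w : Option (Fin j)) : clusterDist L x y Z u w = clusterDist L x y Z w u := by
  cases u <;> cases w <;> simp [clusterDist, min_comm]

/-- **The line bound** `M_ℓ = C (1 + clusterDist ℓ)^{-K}` on the cluster pairs. [folklore] -/
def lineBound (C : ℝ) (K : ℕ) : Sym2 (Option (Fin j)) → ℝ :=
  Sym2.lift ⟨fun u w => C * ((1 + (clusterDist L x y Z u w : ℝ)) ^ K)⁻¹,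
    fun u w => by beta_reduce; rw [clusterDist_comm]⟩

/-- `lineBound` on a pair. [folklore] -/
@[simp] theorem lineBound_mk (C : ℝ) (K : ℕ) (u w : Option (Fin j)) :
    lineBound L x y Z C K s(u, w) = C * ((1 + (clusterDist L x y Z u w : ℝ)) ^ K)⁻¹ := rfl

/-- `0 ≤ M_ℓ ≤ C`. [folklore] -/
theorem lineBound_nonneg {C : ℝ} (hC : 0 ≤ C) (K : ℕ) (ℓ : Sym2 (Option (Fin j))) :
    0 ≤ lineBound L x y Z C K ℓ := by
  induction ℓ using Sym2.inductionOn with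
  | hf u w => rw [lineBound_mk]; positivity

/-- `M_ℓ ≤ C`. [folklore] -/
theorem lineBound_le {C : ℝ} (hC : 0 ≤ C) (K : ℕ) (ℓ : Sym2 (Option (Fin j))) :
    lineBound L x y Z C K ℓ ≤ C := by
  induction ℓ using Sym2.inductionOn with
  | hf u w =>
    rw [lineBound_mk]
    refine mul_le_of_le_one_right hC (inv_le_one_of_one_le₀ (one_le_pow₀ ?_))
    simp

/-- **The cluster distance of a field line is at most the torus distance of its pair of
positions.** [folklore] -/
theorem clusterDist_le_tnZ [NeZero L] (a b : Fin (j * 2 + 1)) :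
    clusterDist L x y Z (hubbardCluster j a) (hubbardCluster j b) ≤
      tnZ L (hubbardWordPos y Z b - hubbardWordPos x Z a) := by
  induction a using Fin.cases with
  | zero =>
    induction b using Fin.cases with
    | zero =>
      rw [hubbardCluster_zero]
      exact Nat.zero_le _
    | succ m =>
      rw [hubbardCluster_zero, hubbardCluster_succ, hubbardWordPos_zero, hubbardWordPos_succ]
      exact min_le_left _ _
  | succ m =>
    induction b using Fin.cases with
    | zero =>
      rw [hubbardCluster_succ, hubbardCluster_zero, hubbardWordPos_zero, hubbardWordPos_succ,
        tnZ_sub_comm (L := L) y]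
      exact min_le_right _ _
    | succ m' =>
      rw [hubbardCluster_succ, hubbardCluster_succ, hubbardWordPos_succ, hubbardWordPos_succ]
      exact min_le_right _ _

/-- **The potential**: the torus distance of a cluster from `x` (zero for the external pair).
[folklore] -/
def clusterPot : Option (Fin j) → ℝ
  | none => 0
  | some i => tnZ L (Z i - x)

/-- The potential is nonnegative. [folklore] -/
theorem clusterPot_nonneg (u : Option (Fin j)) : 0 ≤ clusterPot L x Z u := by
  cases u <;> simp [clusterPot]

/-- **The jump of the potential across a pair of clusters is at most their cluster distance plus
`‖y - x‖_∞`.** [folklore] -/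
theorem clusterPot_le [NeZero L] (u w : Option (Fin j)) :
    clusterPot L x Z w ≤ clusterPot L x Z u + clusterDist L x y Z u w + Site.supNorm (y - x) := by
  have hE : (0 : ℝ) ≤ Site.supNorm (y - x) := Nat.cast_nonneg _
  cases w with
  | none =>
    change (0 : ℝ) ≤ _
    have h1 := clusterPot_nonneg L x Z u
    have h2 : (0 : ℝ) ≤ clusterDist L x y Z u none := Nat.cast_nonneg _
    linarith
  | some i' =>
    cases u with
    | none =>
      simp only [clusterPot, clusterDist, zero_add, Nat.cast_min]
      -- `tnZ (Z i' - x) ≤ tnZ (Z i' - y) + tnZ (y - x)`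
      have h1 : (tnZ L (Z i' - x) : ℝ) ≤ tnZ L (Z i' - y) + tnZ L (y - x) := by
        have := tnZ_add_le (L := L) (Z i' - y) (y - x)
        rw [sub_add_sub_cancel] at this
        exact_mod_cast this
      have h2 : (tnZ L (y - x) : ℝ) ≤ Site.supNorm (y - x) := by exact_mod_cast tnZ_le_supNorm (L := L) (y - x)
      rcases le_total (tnZ L (Z i' - x) : ℝ) (tnZ L (Z i' - y)) with h | h
      · rw [min_eq_left h]; linarith
      · rw [min_eq_right h]; linarith
    | some i =>
      simp only [clusterPot, clusterDist, Nat.cast_min]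
      have h1 : (tnZ L (Z i' - x) : ℝ) ≤ tnZ L (Z i' - Z i) + tnZ L (Z i - x) := by
        have := tnZ_add_le (L := L) (Z i' - Z i) (Z i - x)
        rw [sub_add_sub_cancel] at this
        exact_mod_cast this
      have h2 : (tnZ L (Z i - Z i') : ℝ) = tnZ L (Z i' - Z i) := by exact_mod_cast tnZ_sub_comm (L := L) (Z i) (Z i')
      rw [h2, min_self]
      linarith

end Clusters

/-! ### Domination: the truncated expectation decays in the sup-norm of the centred positions -/

section Domination

variable (β μ : ℝ)

/-- **Domination of the truncated expectation, uniformly in the volume.** For `β ≥ 0`, sites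
`x, y`, spins and order `j` there are `K ≥ 4j` and `D ≥ 0` such that for all `L ≥ 3`, vertex
times `w ∈ [-β, 0]^j` and CENTRED vertex positions `Z`,
`|𝓔ᵀ_L(x, y; Z, w)| ≤ D (1 + ‖Z‖_∞)^{-K}`: the fixed-order tree bound
(`FermionicTree.norm_ursellOf_moment_le_lineBound`) with the uniform torus-distance decay of the
entries along the lines of each anchored cluster tree, all lines bounded by `C` and ONE line — by
the long-line lemma applied to the torus distance from `x`, for the vertex realising `‖Z‖_∞` —
of cluster distance `> (‖Z‖_∞ - ‖x‖ - 1)/j - ‖y - x‖`. (BGM 2006 §2.3 footnote 1 with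
(2.66)–(2.77) at fixed order; [BM2001] §2.) [cite: BenfattoGiulianiMastropietro2006, §2.3 footnote 1] -/
theorem exists_norm_twoPointUrsellZ_le (hβ : 0 ≤ β) (x y : Site 2) (σ σ' : Fin 2) (j : ℕ) :
    ∃ (K : ℕ) (D : ℝ), 2 * (j * 2) ≤ K ∧ 0 ≤ D ∧ ∀ (L : ℕ), 3 ≤ L →
      ∀ (w : Fin j → ℝ), (∀ i, w i ∈ Icc (-β) 0) → ∀ Z : Fin j → Site 2, IsCentred L Z →
        ‖twoPointUrsellZ β μ L x y σ σ' Z (fun i => ((w i : ℝ) : ℂ))‖ ≤ D * ((1 + ‖Z‖) ^ K)⁻¹ := by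
  classical
  -- decay data for the separations `[-2β, β]`
  obtain ⟨C, hCpos, hC⟩ := exists_norm_hubbardThermalTwoPointEvolved_le_tnZ β μ (-(2 * β)) β
    (K := 4 * j + 4) (by omega)
  -- constants
  have hNpos : (0 : ℝ) < (j * 2 + 1 : ℕ) := by positivity
  set C₁ : ℝ := Real.sqrt (j * 2 + 1 : ℕ) * C with hC₁
  have hC₁pos : 0 < C₁ := mul_pos (Real.sqrt_pos.2 hNpos) hCpos
  set B₀ : ℝ := 2 * ((j * 2 + 1 : ℕ) : ℝ) ^ 2 * (C / C₁) with hB₀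
  have hB₀nn : 0 ≤ B₀ := by positivity
  set E : ℝ := (Site.supNorm (y - x) : ℝ) with hE
  have hE0 : 0 ≤ E := Nat.cast_nonneg _
  set R₀ : ℝ := ‖x‖ + 1 + j * (1 + E) with hR₀
  have hR₀nn : 0 ≤ R₀ := by positivity
  set A : ℝ := (j + 1) * (1 + R₀) with hA
  have hA1 : 1 + R₀ ≤ A := by
    rw [hA]
    have : (0 : ℝ) ≤ j * (1 + R₀) := by positivity
    linarith
  have hApos : 0 < A := by positivity
  set S : ℝ := ∑ T ∈ lineSets (none : Option (Fin j)) (univ : Finset (Option (Fin j))), B₀ ^ T.card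
    with hS
  have hS0 : 0 ≤ S := sum_nonneg fun T _ => pow_nonneg hB₀nn _
  refine ⟨4 * j + 4, C₁ ^ (j * 2 + 1) * S * A ^ (4 * j + 4), by omega, by positivity,
    fun L hL w hw Z hZ => ?_⟩
  set K : ℕ := 4 * j + 4 with hK
  haveI : NeZero L := ⟨by omega⟩
  set M := torusWordMatrix β μ L x y σ σ' Z (fun i => ((w i : ℝ) : ℂ)) with hM
  -- entry bounds
  have hent : ∀ a b, ‖M a b‖ ≤
      C * ((1 + (tnZ L (hubbardWordPos y Z b - hubbardWordPos x Z a) : ℝ)) ^ K)⁻¹ :=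
    fun a b => norm_torusWordMatrix_apply_le β μ hβ hC hL x y σ σ' Z hw a b
  have hG0 : ∀ a b, ‖M a b‖ ≤ C := fun a b => (hent a b).trans
    (mul_le_of_le_one_right hCpos.le (inv_le_one_of_one_le₀ (one_le_pow₀ (by simp))))
  have hGM : ∀ a b, ‖M a b‖ ≤ lineBound L x y Z C K s(hubbardCluster j a, hubbardCluster j b) := by
    intro a b
    rw [lineBound_mk]
    refine (hent a b).trans (mul_le_mul_of_nonneg_left ?_ hCpos.le)
    refine inv_anti₀ (by positivity) (pow_le_pow_left₀ (by positivity) ?_ K)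
    have h := clusterDist_le_tnZ L x y Z a b
    have h' : (clusterDist L x y Z (hubbardCluster j a) (hubbardCluster j b) : ℝ) ≤
        tnZ L (hubbardWordPos y Z b - hubbardWordPos x Z a) := by exact_mod_cast h
    linarith
  -- the fixed-order tree bound
  have hbound := FermionicTree.norm_ursellOf_moment_le_lineBound (𝕜 := ℂ) (hubbardCluster j) M hCpos
    hG0 (lineBound L x y Z C K) (lineBound_nonneg L x y Z hCpos.le K) hGM (j * 2 + 1)
    (fun u => (card_le_univ _).trans (by rw [Fintype.card_fin])) none
  rw [Fintype.card_fin] at hbound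
  change ‖ursellOf (FermionicTree.moment (hubbardCluster j) M) univ‖ ≤ _
  refine hbound.trans ?_
  -- the factors along the lines, and the per-tree estimate (long-line lemma)
  set ε : ℝ := A ^ K * ((1 + ‖Z‖) ^ K)⁻¹ with hε
  have hεnn : 0 ≤ ε := by positivity
  set f : Sym2 (Option (Fin j)) → ℝ := fun ℓ => 2 * ((j * 2 + 1 : ℕ) : ℝ) ^ 2 * (lineBound L x y Z C K ℓ / C₁)
    with hf
  have hf0 : ∀ ℓ, 0 ≤ f ℓ := fun ℓ =>
    mul_nonneg (by positivity) (div_nonneg (lineBound_nonneg L x y Z hCpos.le K ℓ) hC₁pos.le)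
  have hfB : ∀ ℓ, f ℓ ≤ B₀ := fun ℓ =>
    mul_le_mul_of_nonneg_left (div_le_div_of_nonneg_right (lineBound_le L x y Z hCpos.le K ℓ) hC₁pos.le)
      (by positivity)
  have hprodB : ∀ T' : Finset (Sym2 (Option (Fin j))), ∏ ℓ ∈ T', f ℓ ≤ B₀ ^ T'.card := fun T' =>
    (prod_le_prod (fun ℓ _ => hf0 ℓ) fun ℓ _ => hfB ℓ).trans (by rw [prod_const])
  have key : ∀ T ∈ lineSets (none : Option (Fin j)) (univ : Finset (Option (Fin j))),
      ∏ ℓ ∈ T, f ℓ ≤ B₀ ^ T.card * ε := by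
    intro T hT
    obtain ⟨k, -, s, hs, hsu, rfl⟩ := mem_lineSets.1 hT
    by_cases hR : ‖Z‖ ≤ R₀
    · -- near configurations: the trivial bound, `ε ≥ 1`
      have hε1 : 1 ≤ ε := by
        rw [hε, le_mul_inv_iff₀ (by positivity), one_mul]
        exact pow_le_pow_left₀ (by positivity) (by linarith) K
      exact (hprodB _).trans (le_mul_of_one_le_right (pow_nonneg hB₀nn _) hε1)
    · -- far configurations: a long line
      push Not at hR
      have hj : 0 < j := by
        rcases Nat.eq_zero_or_pos j with h0 | h0
        · exfalso
          subst h0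
          have : ‖Z‖ = 0 := by rw [Subsingleton.elim Z 0, norm_zero]
          linarith
        · exact h0
      have hjR : (0 : ℝ) < j := by exact_mod_cast hj
      have hZpos : 0 < ‖Z‖ := hR₀nn.trans_lt hR
      obtain ⟨i₀, hi₀⟩ : ∃ i, ‖Z‖ ≤ ‖Z i‖ := by
        by_contra hcon
        push Not at hcon
        exact lt_irrefl _ ((pi_norm_lt_iff hZpos).2 hcon)
      -- the script has `j` lines
      have hk : k = j := by
        have h := Script.card_image_y s hs
        rw [hsu, card_univ, Fintype.card_option, Fintype.card_fin] at h
        omega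
      -- the potential of the far vertex
      have hpot : ‖Z‖ - ‖x‖ ≤ clusterPot L x Z (some i₀) := by
        change ‖Z‖ - ‖x‖ ≤ (tnZ L (Z i₀ - x) : ℝ)
        have h1 := tnZ_sub_le_real (L := L) (Z i₀) x
        have h2 : (tnZ L (Z i₀) : ℝ) = ‖Z i₀‖ := by
          rw [Site.norm_eq_supNorm]; exact_mod_cast tnZ_eq_supNorm_of_centred L (hZ i₀)
        have h3 : (tnZ L x : ℝ) ≤ ‖x‖ := by
          rw [Site.norm_eq_supNorm]; exact_mod_cast tnZ_le_supNorm (L := L) x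
        linarith
      obtain ⟨m₀, hm₀⟩ : ∃ m, s.y m = some i₀ := by
        have h : some i₀ ∈ (Finset.univ : Finset (Fin (k + 1))).image s.y := by
          rw [hsu]; exact Finset.mem_univ _
        obtain ⟨m, -, hm⟩ := Finset.mem_image.1 h
        exact ⟨m, hm⟩
      -- the threshold
      set lam : ℝ := (‖Z‖ - ‖x‖ - 1) / j - E with hlam
      have hjlam : (j : ℝ) * lam = ‖Z‖ - ‖x‖ - 1 - j * E := by
        rw [hlam]; field_simp
      have hR' : ‖x‖ + 1 + j * (1 + E) < ‖Z‖ := hR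
      have hlam1 : 1 < lam := by
        by_contra hle
        push Not at hle
        have : (j : ℝ) * lam ≤ j * 1 := mul_le_mul_of_nonneg_left hle hjR.le
        linarith
      have hlt : clusterPot L x Z none + k * (lam + E) < clusterPot L x Z (s.y m₀) := by
        rw [hm₀, hk]
        change (0 : ℝ) + j * (lam + E) < _
        have : (j : ℝ) * (lam + E) = ‖Z‖ - ‖x‖ - 1 := by rw [mul_add, hjlam]; ring
        linarith
      obtain ⟨ℓ, hℓ, u, hu, v', hv', hjump⟩ :=
        Script.exists_line_lt_of_lt_apply_y (clusterPot L x Z) (lam := lam + E) (by linarith) s hlt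
      have huv : u ≠ v' := by
        rintro rfl
        linarith
      have hℓeq : ℓ = s(u, v') := (Sym2.mem_and_mem_iff huv).1 ⟨hu, hv'⟩
      -- the cluster distance of the long line
      have hcd : lam < clusterDist L x y Z u v' := by
        have h := clusterPot_le L x y Z u v'
        linarith
      -- its factor is small
      have hAlam : 1 + ‖Z‖ ≤ A * (1 + lam) := by
        have h1 : (j : ℝ) * (1 + lam) ≤ (j + 1) * (1 + lam) := by
          have : (0 : ℝ) ≤ 1 + lam := by linarith
          linarith
        have h2 : (j : ℝ) * (1 + lam) = ‖Z‖ - R₀ + 2 * j := by rw [mul_add, hjlam, hR₀]; ring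
        have h3 : 1 + ‖Z‖ ≤ (1 + R₀) * ((j : ℝ) * (1 + lam)) := by
          rw [h2]
          have hj1 : (1 : ℝ) ≤ j := by exact_mod_cast hj
          have p1 : 0 ≤ R₀ * (‖Z‖ - R₀) := mul_nonneg hR₀nn (sub_nonneg.2 hR.le)
          have p2 : R₀ ≤ R₀ * j := le_mul_of_one_le_right hR₀nn hj1
          have hexp : (1 + R₀) * (‖Z‖ - R₀ + 2 * j) =
              ‖Z‖ + R₀ * (‖Z‖ - R₀) + 2 * (R₀ * j) - R₀ + 2 * j := by ring
          rw [hexp]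
          linarith
        calc 1 + ‖Z‖ ≤ (1 + R₀) * ((j : ℝ) * (1 + lam)) := h3
          _ ≤ (1 + R₀) * ((j + 1) * (1 + lam)) := mul_le_mul_of_nonneg_left h1 (by positivity)
          _ = A * (1 + lam) := by rw [hA]; ring
      have hcmp : ((1 + (clusterDist L x y Z u v' : ℝ)) ^ K)⁻¹ ≤ ε := by
        have h1 : (1 + ‖Z‖) / A ≤ 1 + (clusterDist L x y Z u v' : ℝ) := by
          rw [div_le_iff₀ hApos]
          have : A * lam ≤ A * (clusterDist L x y Z u v' : ℝ) := mul_le_mul_of_nonneg_left hcd.le hApos.le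
          linarith
        have h2 : 0 < (1 + ‖Z‖) / A := by positivity
        calc ((1 + (clusterDist L x y Z u v' : ℝ)) ^ K)⁻¹ ≤ (((1 + ‖Z‖) / A) ^ K)⁻¹ :=
              inv_anti₀ (by positivity) (pow_le_pow_left₀ h2.le h1 K)
          _ = ε := by rw [hε, div_pow, inv_div, div_eq_mul_inv]
      have hfl : f ℓ ≤ B₀ * ε := by
        rw [hℓeq, hf]
        simp only [lineBound_mk]
        calc 2 * ((j * 2 + 1 : ℕ) : ℝ) ^ 2 * (C * ((1 + (clusterDist L x y Z u v' : ℝ)) ^ K)⁻¹ / C₁)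
            = B₀ * ((1 + (clusterDist L x y Z u v' : ℝ)) ^ K)⁻¹ := by rw [hB₀]; ring
          _ ≤ B₀ * ε := mul_le_mul_of_nonneg_left hcmp hB₀nn
      -- assemble the product over the lines of the tree
      have hℓT : ℓ ∈ s.lines.toFinset := List.mem_toFinset.2 hℓ
      rw [← mul_prod_erase _ _ hℓT]
      have hrest := hprodB (s.lines.toFinset.erase ℓ)
      rw [card_erase_of_mem hℓT] at hrest
      have hcard : 1 ≤ s.lines.toFinset.card := card_pos.2 ⟨ℓ, hℓT⟩
      calc f ℓ * ∏ ℓ' ∈ s.lines.toFinset.erase ℓ, f ℓ' ≤ (B₀ * ε) * B₀ ^ (s.lines.toFinset.card - 1) :=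
            mul_le_mul hfl hrest (prod_nonneg fun ℓ' _ => hf0 ℓ') (mul_nonneg hB₀nn hεnn)
        _ = B₀ ^ s.lines.toFinset.card * ε := by
            rw [mul_right_comm, ← pow_succ', Nat.sub_add_cancel hcard]
  calc C₁ ^ (j * 2 + 1) * ∑ T ∈ lineSets (none : Option (Fin j)) univ, ∏ ℓ ∈ T, f ℓ
      ≤ C₁ ^ (j * 2 + 1) * ∑ T ∈ lineSets (none : Option (Fin j)) univ, B₀ ^ T.card * ε :=
        mul_le_mul_of_nonneg_left (sum_le_sum key) (pow_nonneg hC₁pos.le _)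
    _ = C₁ ^ (j * 2 + 1) * S * A ^ K * ((1 + ‖Z‖) ^ K)⁻¹ := by rw [← sum_mul, hS, hε]; ring

end Domination

/-! ### Assembly: Tannery over the positions, dominated convergence over the times -/

section Assembly

variable (β μ : ℝ)

/-- The weights `(1 + ‖Z‖_∞)^{-K}` are summable over `(ℤ²)^j` for `K ≥ 4j` (flatten `Z` into
`ℤ^{2j}`). [folklore] -/
theorem summable_inv_one_add_norm_pow_pi {j K : ℕ} (hK : 2 * (j * 2) ≤ K) :
    Summable fun Z : Fin j → Site 2 => ((1 + ‖Z‖) ^ K)⁻¹ := by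
  set e : (Fin j → Site 2) → Site (j * 2) := fun Z m =>
    Z (finProdFinEquiv.symm m).1 (finProdFinEquiv.symm m).2 with he
  have hinj : Function.Injective e := by
    intro Z Z' h
    funext i k
    have := congr_fun h (finProdFinEquiv (i, k))
    simp only [he, Equiv.symm_apply_apply] at this
    exact this
  have hle : ∀ Z, ‖e Z‖ ≤ ‖Z‖ := fun Z => by
    refine (pi_norm_le_iff_of_nonneg (norm_nonneg _)).2 fun m => ?_
    exact (norm_le_pi_norm (Z (finProdFinEquiv.symm m).1) _).trans (norm_le_pi_norm Z _)
  have hs := (summable_inv_one_add_norm_pow (d := j * 2) (K := K) hK).comp_injective hinj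
  refine Summable.of_nonneg_of_le (fun Z => by positivity) (fun Z => ?_) hs
  rw [Function.comp_apply]
  exact inv_anti₀ (by positivity) (pow_le_pow_left₀ (by positivity) (by linarith [hle Z]) K)

/-- **The integrand of `t_j(L)`** as a function of the volume: for `L ≠ 0` the
`truncatedIntegrand` of `HubbardLinkedCluster` for the torus of side `L` (junk `0` at `L = 0`), so
that `t_j(L) = orderedIntegral j (torusTruncatedIntegrand L) 1` for every `L`
(`hubbardTorusTruncatedCoeff_eq_orderedIntegral`). [cite: BenfattoGiulianiMastropietro2006, §2.2 (2.14)] -/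
def torusTruncatedIntegrand (L : ℕ) (x y : Site 2) (σ σ' : Fin 2) (j : ℕ) : (Fin j → ℝ) → ℂ :=
  if hL : L = 0 then 0
  else
    haveI : NeZero L := ⟨hL⟩
    truncatedIntegrand β (hubbardOneBody (fermionTorusGraph 2 L) 1 μ)
      (orb (FermionTorus.ofTorusSite (Torus.proj L x)) σ)
      (orb (FermionTorus.ofTorusSite (Torus.proj L y)) σ') j

/-- `t_j(L) = ∫_{Δ_j} torusTruncatedIntegrand L` for every `L`. [folklore] -/
theorem hubbardTorusTruncatedCoeff_eq_orderedIntegral (L : ℕ) (x y : Site 2) (σ σ' : Fin 2) (j : ℕ) :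
    hubbardTorusTruncatedCoeff β μ L x y σ σ' j =
      orderedIntegral j (torusTruncatedIntegrand β μ L x y σ σ' j) 1 := by
  unfold hubbardTorusTruncatedCoeff torusTruncatedIntegrand
  split_ifs with hL
  · exact (orderedIntegral_zero_fun j 1).symm
  · rfl

/-- The integrand is continuous in the times. [folklore] -/
theorem continuous_torusTruncatedIntegrand (L : ℕ) (x y : Site 2) (σ σ' : Fin 2) (j : ℕ) :
    Continuous (torusTruncatedIntegrand β μ L x y σ σ' j) := by
  unfold torusTruncatedIntegrand
  split_ifs with hL
  · exact continuous_const
  · exact continuous_truncatedIntegrand _ _ _ _ j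

/-- For `L ≠ 0` the integrand is `(-β)^j` times the sum over the centred integer configurations of
the truncated expectation `twoPointUrsellZ` (bridge and `sum_twoPointUrsell_torus_eq_tsum`).
[folklore] -/
theorem torusTruncatedIntegrand_eq_tsum {L : ℕ} [NeZero L] (x y : Site 2) (σ σ' : Fin 2) (j : ℕ)
    (v : Fin j → ℝ) :
    torusTruncatedIntegrand β μ L x y σ σ' j v = (-(β : ℂ)) ^ j *
      ∑' Z : Fin j → Site 2, if IsCentred L Z then
        twoPointUrsellZ β μ L x y σ σ' Z (fun i => ((v i : ℝ) : ℂ) * -(β : ℂ)) else 0 := by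
  unfold torusTruncatedIntegrand
  rw [dif_neg (NeZero.ne L)]
  unfold truncatedIntegrand
  rw [sum_twoPointUrsell_torus_eq_tsum]

/-- **The infinite-volume truncated coefficient** `τ_j`: the same ordered time integral of
`(-β)^j Σ_{Z ∈ (ℤ²)^j} 𝓔ᵀ_∞(x, y; Z, -βv)`, with the infinite-volume propagator
`g = freePropagatorInfiniteTime β μ` (the order-`j` linked-cluster coefficient of the 2D Hubbard
model "in the limit `L → ∞`", BGM 2006 (2.14)–(2.16) with (2.4)). [cite: BenfattoGiulianiMastropietro2006, §2.2 (2.14)-(2.16)] -/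
def hubbardInfTruncatedCoeff (x y : Site 2) (σ σ' : Fin 2) (j : ℕ) : ℂ :=
  orderedIntegral j (fun v : Fin j → ℝ => (-(β : ℂ)) ^ j *
    ∑' Z : Fin j → Site 2, twoPointUrsellInf β μ x y σ σ' Z (fun i => ((v i : ℝ) : ℂ) * -(β : ℂ))) 1

/-- **The termwise (order-by-order) thermodynamic limit of the linked-cluster coefficients of the
2D Hubbard two-point function**: for every `β ≥ 0`, `μ`, sites `x, y`, spins and order `j`,
`t_j(L) = hubbardTorusTruncatedCoeff β μ L x y σ σ' j → τ_j = hubbardInfTruncatedCoeff β μ x y σ σ' j`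
as `L → ∞` — hypothesis (B) of `bgm_two_point_limit_of_truncated_bounds`: Tannery's theorem over
the centred vertex configurations (domination `exists_norm_twoPointUrsellZ_le`, pointwise limits
`tendsto_twoPointUrsellZ`, `eventually_isCentred`) at fixed times, then dominated convergence for
the ordered time integrals (`tendsto_orderedIntegral_of_dominated'`). BGM 2006, §2.3 footnote 1
("performing bounds at finite `L`, showing uniformity in `L` and then performing the limit").
[cite: BenfattoGiulianiMastropietro2006, §2.3 footnote 1] -/
theorem tendsto_hubbardTorusTruncatedCoeff (hβ : 0 ≤ β) (x y : Site 2) (σ σ' : Fin 2) (j : ℕ) :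
    Tendsto (fun L : ℕ => hubbardTorusTruncatedCoeff β μ L x y σ σ' j) atTop
      (𝓝 (hubbardInfTruncatedCoeff β μ x y σ σ' j)) := by
  classical
  obtain ⟨K, D, hK, hD, hdom⟩ := exists_norm_twoPointUrsellZ_le β μ hβ x y σ σ' j
  have hsum : Summable fun Z : Fin j → Site 2 => D * ((1 + ‖Z‖) ^ K)⁻¹ :=
    (summable_inv_one_add_norm_pow_pi hK).mul_left D
  -- the complex vertex times of `v ∈ [0,1]^j` are the real times `-β v ∈ [-β, 0]^j`
  have hτ : ∀ v : Fin j → ℝ, (fun i => ((v i : ℝ) : ℂ) * -(β : ℂ)) = fun i => (((v i * -β : ℝ)) : ℂ) := by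
    intro v; funext i; push_cast; ring
  have hw : ∀ v : Fin j → ℝ, (∀ i, v i ∈ Icc (0 : ℝ) 1) → ∀ i, v i * -β ∈ Icc (-β) 0 := by
    intro v hv i
    refine ⟨?_, ?_⟩
    · nlinarith [(hv i).1, (hv i).2, hβ]
    · nlinarith [(hv i).1, (hv i).2, hβ]
  -- (1) the position sums at fixed times converge (Tannery)
  have hpos : ∀ v : Fin j → ℝ, (∀ i, v i ∈ Icc (0 : ℝ) 1) →
      Tendsto (fun L : ℕ => ∑' Z : Fin j → Site 2, if IsCentred L Z then
          twoPointUrsellZ β μ L x y σ σ' Z (fun i => ((v i : ℝ) : ℂ) * -(β : ℂ)) else 0) atTop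
        (𝓝 (∑' Z : Fin j → Site 2, twoPointUrsellInf β μ x y σ σ' Z (fun i => ((v i : ℝ) : ℂ) * -(β : ℂ)))) := by
    intro v hv
    refine tendsto_tsum_of_dominated_convergence hsum (fun Z => ?_) ?_
    · refine (tendsto_twoPointUrsellZ β μ x y σ σ' Z _).congr' ?_
      filter_upwards [eventually_isCentred Z] with L hL
      rw [if_pos hL]
    · filter_upwards [eventually_ge_atTop 3] with L hL Z
      split_ifs with hc
      · rw [hτ v]
        exact hdom L hL _ (hw v hv) Z hc
      · rw [norm_zero]; positivity
  -- (2) the uniform bound on the integrands for `L ≥ 3`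
  set B : ℝ := |β| ^ j * ∑' Z : Fin j → Site 2, D * ((1 + ‖Z‖) ^ K)⁻¹ with hB
  have hB0 : 0 ≤ B := mul_nonneg (pow_nonneg (abs_nonneg β) j) (tsum_nonneg fun Z => by positivity)
  have hbd : ∀ (L : ℕ), 3 ≤ L → ∀ v : Fin j → ℝ, (∀ i, v i ∈ Icc (0 : ℝ) 1) →
      ‖torusTruncatedIntegrand β μ L x y σ σ' j v‖ ≤ B := by
    intro L hL v hv
    haveI : NeZero L := ⟨by omega⟩
    rw [torusTruncatedIntegrand_eq_tsum, norm_mul, norm_pow, norm_neg, Complex.norm_real, Real.norm_eq_abs]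
    refine mul_le_mul_of_nonneg_left ?_ (pow_nonneg (abs_nonneg β) j)
    refine tsum_of_norm_bounded hsum.hasSum fun Z => ?_
    split_ifs with hc
    · rw [hτ v]
      exact hdom L hL _ (hw v hv) Z hc
    · rw [norm_zero]; positivity
  -- (3) dominated convergence for the ordered time integrals, along `L = n + 3`
  have hconv : Tendsto (fun n : ℕ => orderedIntegral j (torusTruncatedIntegrand β μ (n + 3) x y σ σ' j) 1)
      atTop (𝓝 (hubbardInfTruncatedCoeff β μ x y σ σ' j)) := by
    refine tendsto_orderedIntegral_of_dominated' j (fun n => torusTruncatedIntegrand β μ (n + 3) x y σ σ' j)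
      _ zero_le_one hB0 (fun n => continuous_torusTruncatedIntegrand β μ _ x y σ σ' j)
      (fun n v hv => hbd (n + 3) (by omega) v hv) (fun v hv => ?_)
    haveI : ∀ n : ℕ, NeZero (n + 3) := fun n => ⟨by omega⟩
    have hev : (fun n : ℕ => torusTruncatedIntegrand β μ (n + 3) x y σ σ' j v) = fun n : ℕ =>
        (-(β : ℂ)) ^ j * ∑' Z : Fin j → Site 2, if IsCentred (n + 3) Z then
          twoPointUrsellZ β μ (n + 3) x y σ σ' Z (fun i => ((v i : ℝ) : ℂ) * -(β : ℂ)) else 0 := by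
      funext n
      exact torusTruncatedIntegrand_eq_tsum β μ x y σ σ' j v
    rw [hev]
    exact ((hpos v hv).comp (tendsto_add_atTop_nat 3)).const_mul _
  rw [← tendsto_add_atTop_iff_nat 3]
  simpa only [hubbardTorusTruncatedCoeff_eq_orderedIntegral] using hconv

/-- **Hypothesis (B) of `bgm_two_point_limit_of_truncated_bounds` holds**: the termwise limits of
the truncated coefficients exist for every `β ≥ 0`. [cite: BenfattoGiulianiMastropietro2006, §2.3 footnote 1] -/
theorem termwise_limit_hubbardTorusTruncatedCoeff (hβ : 0 ≤ β) (x y : Site 2) (σ σ' : Fin 2) :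
    ∀ j : ℕ, Tendsto (fun L : ℕ => hubbardTorusTruncatedCoeff β μ L x y σ σ' j) atTop
      (𝓝 (hubbardInfTruncatedCoeff β μ x y σ σ' j)) :=
  fun j => tendsto_hubbardTorusTruncatedCoeff β μ hβ x y σ σ' j

/-- **Reduction of the fact `bgm_two_point_limit` to the volume-uniform geometric bound ALONE.**
If in BGM's regime (`-4 < μ < -2-√2`, `0 < |U| ≤ U₀`, `0 < β ≤ e^{c/|U|}`) the truncated coefficients
admit, for every pair of sites and spins, a bound `‖t_j(L)‖ ≤ C/rʲ` with `|U| < r` for all large `L`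
(BGM's Theorem 2.1 with the multiscale analysis of §3, made uniform in `L` as in [BM2001]), then
the finite-volume two-point functions converge: the termwise limits required by
`bgm_two_point_limit_of_truncated_bounds` are supplied by `termwise_limit_hubbardTorusTruncatedCoeff`.
(A proved reduction; the analytic input (A) is NOT asserted here.) [cite: BenfattoGiulianiMastropietro2006, Thm. 1.1, Thm. 2.1] -/
theorem bgm_two_point_limit_of_uniform_truncated_bound
    (h : ∀ μ : ℝ, -4 < μ → μ < -2 - Real.sqrt 2 → ∃ U₀ c : ℝ, 0 < U₀ ∧ 0 < c ∧
      ∀ U β : ℝ, U ≠ 0 → |U| ≤ U₀ → 0 < β → β ≤ Real.exp (c / |U|) →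
        ∀ (x y : Site 2) (σ σ' : Fin 2), ∃ (r C : ℝ), |U| < r ∧
          ∀ᶠ L : ℕ in atTop, ∀ j : ℕ, ‖hubbardTorusTruncatedCoeff β μ L x y σ σ' j‖ ≤ C / r ^ j) :
    bgm_two_point_limit := by
  refine bgm_two_point_limit_of_truncated_bounds fun μ hμ1 hμ2 => ?_
  obtain ⟨U₀, c, hU₀, hc, hreg⟩ := h μ hμ1 hμ2
  refine ⟨U₀, c, hU₀, hc, fun U β hU0 hUU₀ hβ hβc x y σ σ' => ?_⟩
  obtain ⟨r, C, hUr, hC⟩ := hreg U β hU0 hUU₀ hβ hβc x y σ σ'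
  exact ⟨r, C, _, hUr, hC, termwise_limit_hubbardTorusTruncatedCoeff β μ hβ.le x y σ σ'⟩

end Assembly

end Literature.MathematicalPhysics.QuantumLattice

end
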